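import Summits.BirchSwinnertonDyer.Rank1Residual.X1.GeneratorCountLayerTransport
import Summits.BirchSwinnertonDyer.Rank1Residual.X1.GeneratorCountMu
import Summits.BirchSwinnertonDyer.Rank1Residual.Additive.BudgetFromTamagawaCertificatesLayerNoTate
import HarnessLib

/-!
# Route T at LAYER `n` from the three census columns, at a member of ANY `μ`:
# `Σ_{v ∈ S} p^{min(n, m_v)} ≤ λ + pⁿ μ` (cell `b2b-bsdres`, unit `b2b-bsdres-eisenstein-p1`, gen 17;
# X1R0-GAPMAP §14.1, §26)

HONEST FRAMING (run/shared/lean/b2b/bsd-rank1-residual/, verbatim in every file): the goal of the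
cell is to DELETE the COMBINATION-SHAPED residual classes of the Birch–Swinnerton-Dyer formula for
ALL analytic-rank `≤ 1` elliptic curves over `ℚ` — "full BSD formula for every rank `≤ 1` curve in
class `C`" assembled STRICTLY from published theorems — so that the rank-`≤ 1` remainder becomes
exactly the CONSTRUCTION-SHAPED classes, which are TYPED (missing-input `Prop`s), NOT attempted.
This is not "finishing BSD". Sub-cell `b2b-bsdres-eisenstein-p1` (CLASS-OWNERS row "X1 (r = 0)"):
research route; NO CLAIM BEYOND STATED CLASSES; nothing here changes a label; nothing is booked.
THEOREMS ONLY — no definition, no named fact, no typed input introduced; census certificates enter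
as HYPOTHESES per row, never as facts; nothing about any particular curve asserted.

## What and why

n1011's `budgetLeLambdaAt_layer_of_certificates_of_dvd` (`Additive/BudgetFromTamagawaCertificatesLayerNoTate`)
turns the three census columns of a Tamagawa row — `v ∤ p`, the place-count certificate
`v_p(N(v)^{p−1} − 1) = m_v + 1`, `p ∣ c_v` — into `BudgetLeLambdaAt p W (Σ_v p^{min(n, m_v)})`,
i.e. `t_n ≤ λ` at layer `n` for dual data WITH `μ = 0`. Route T's census (X1R0-GAPMAP §14.1) uses
`t_n ≤ λ + pⁿ μ` at EVERY member. Gen 17 FILE 6 (`X1/GeneratorCountLayerTransport`) made the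
transport `Γ`-equivariant, so the layer-`n` classes are counted by `X/(p, ω_n)X`, bounded by
`p^{λ + pⁿμ}` (FILE 5). THIS FILE is the census-column assembly, verbatim n1011's (place counts
`pow_min_eq_natCard_placesOver_layer`, witnesses `…_layer_of_odd_of_dvd_localTamagawaNumber`, glue
`exists_finset_placesOver_card_ge`), ending in FILE 6 instead of the `μ = 0` socket:

* §1 `sum_pow_min_le_lambda_add_pow_mul_mu_of_certificates`: for `E = W/ℚ` globally minimal, `p` odd
  with `p ∤ #E(ℚ)_tors`, a cyclotomic `κ` and ANY torsion dual datum `D` over `(κ, γ)` without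
  nonzero finite submodules — **`Σ_{v ∈ S} p^{min(n, m_v)} ≤ λ(X) + pⁿ μ(X)`**, modulo Poitou–Tate
  duality over `ℚ_n` (`hPT`) and the local Euler–Poincaré formula at the places of `ℚ_n` (`hEP`),
  named PUBLISHED facts exactly as in n1011's MAIN.
* §2 on the leaf X1 ∩ {r = 0} at a member of ANY `μ`: **`AlgebraicLambdaMem W p
  {d | Σ_{v ∈ S} p^{min(n, m_v)} ≤ d + pⁿ m}`** from `AnalyticMuLE W p m` (FILE 3
  `GeneratorCountMu.mu_le_of_analyticMuLE`) and `NoFiniteSubmoduleAt` (Prop. 4.14 by name from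
  `p ∤ #E(ℚ)_tors`), and the END `Leaf.bsdp_of_muPartAt_of_layerCertificates_inter_of_prop414`
  intersecting it with any layer-`0` certificate `A'` (e.g. FILE 3's M₀ ∧ Greenberg set).

HONEST LIMITS: the local term `a` at the prime above `p` and the `δ = 1` members (`p ∣ #E(ℚ)_tors`)
are NOT covered at layers `n ≥ 1`; LEMMA M at layer `n` is not in the kernel. The census classes
still open after gen 17 (X1R0-GAPMAP §26.1: 4 `TAM+LB` + 7 `M:paper`) all need one of these, so this
file books none of them; it makes route T's pure-Tamagawa layer-`n` bound kernel-shaped at every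
member. Nothing is booked by this file.

References: [GreenbergLNM1716] §3 pp. 85–86, §5 pp. 114–118 (proof of Cor. 5.6), Prop. 4.14,
p. 137; [Washington1997] §13.1 (Prop. 13.2), §13.2; X1R0-GAPMAP §14.1, §26.
-/

noncomputable section

open scoped Classical

open Function Field NumberField IsDedekindDomain WeierstrassCurve PowerSeries
  Literature.NumberTheory.EllipticCurves Literature.NumberTheory.GaloisRepresentations
  Literature.NumberTheory.GaloisCohomology
  Literature.NumberTheory.EllipticCurves.IwasawaAlgebra IsLocalRing
  Literature.NumberTheory.EllipticCurves.ModularForms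
  Literature.NumberTheory.EllipticCurves.Rank1Residual
  Literature.NumberTheory.EllipticCurves.Greenberg1999
  Summit.BirchSwinnertonDyer.BirchSwinnertonDyer.Theorems.Rank1ResidualX1Defs
  Summit.BirchSwinnertonDyer.Rank1Residual.Additive
  Summit.BirchSwinnertonDyer.Rank1Residual.Additive.ZpTower
  Summit.BirchSwinnertonDyer.Rank1Residual.X1.MuLambda
  Summit.BirchSwinnertonDyer.Rank1Residual.X1.MuPart
  Summit.BirchSwinnertonDyer.Rank1Residual.X1.ParitySqueeze
  Summit.BirchSwinnertonDyer.Rank1Residual.X1.TamagawaSqueeze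
  Summit.BirchSwinnertonDyer.Rank1Residual.X1.FactorSqueeze
  Summit.BirchSwinnertonDyer.Rank1Residual.X1.GeneratorSqueeze
  Summit.BirchSwinnertonDyer.Rank1Residual.X1.GeneratorCountSqueeze
  Summit.BirchSwinnertonDyer.Rank1Residual.X1.GeneratorCountSqueezeFacts
  Summit.BirchSwinnertonDyer.Rank1Residual.X1.GeneratorCountMu
  Summit.BirchSwinnertonDyer.Rank1Residual.X1.GeneratorCountLayerTransport
  Summit.BirchSwinnertonDyer.Rank1Residual.X1.GeneratorBoundMuLayer
open Literature.NumberTheory.GaloisRepresentations.DiscreteGaloisModule (unramifiedSubgroup)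

set_option autoImplicit false

namespace Summit.BirchSwinnertonDyer.Rank1Residual.X1.GeneratorCountLayerCertificates

variable {W : WeierstrassCurve ℚ} [W.IsElliptic] [W.IsGloballyMinimal] {p : ℕ} [hp : Fact p.Prime]

/-! ## §1. `Σ_{v ∈ S} p^{min(n, m_v)} ≤ λ(X) + pⁿ μ(X)` from the three census columns -/

/-- **Route T's layer-`n` Tamagawa bound from the three census columns, ANY `μ`.** Let `E = W/ℚ`
be globally minimal elliptic, `p` odd with `p ∤ #E(ℚ)_tors`, `κ` cyclotomic with any `γ`, and `D` a
Pontryagin-dual datum of `Sel_{p^∞}(E/ℚ_∞)` with `X = D.X` finitely generated, torsion and without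
nonzero finite submodules. For a finite set `S` of places `v` with `v ∤ p`,
`v_p(N(v)^{p−1} − 1) = m_v + 1` and `p ∣ c_v`: modulo Poitou–Tate duality over `ℚ_n` (`hPT`) and
the local Euler–Poincaré formula at the places of `ℚ_n` (`hEP`),
**`Σ_{v ∈ S} p^{min(n, m_v)} ≤ λ(X) + pⁿ μ(X)`** — n1011's census-column assembly (`#{w ∣ v} =
p^{min(n,m_v)}`, a witness at every `w ∣ v`) fed to FILE 6's
`card_le_lambda_add_pow_mul_mu_of_tamagawaWitnesses_layer` over the restricted tower.
[cite: GreenbergLNM1716, §5 pp. 114–118, p. 137] [cite: Washington1997, §13.1 (Prop. 13.2)] -/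
theorem sum_pow_min_le_lambda_add_pow_mul_mu_of_certificates (hodd : p ≠ 2)
    (htors : ¬ p ∣ W.torsionOrder) (n : ℕ)
    (hPT : ∀ (κ : ZpExtension ℚ p) [NumberField (κ.layer n)], κ.IsCyclotomic →
      poitouTate_selmerStructure_duality (κ.layer n))
    (hEP : ∀ (κ : ZpExtension ℚ p) [NumberField (κ.layer n)], κ.IsCyclotomic →
      ∀ w : HeightOneSpectrum (𝓞 (κ.layer n)),
      localEulerPoincareCharacteristic (w.adicCompletion (κ.layer n)))
    (S : Finset (HeightOneSpectrum (𝓞 ℚ))) (m : HeightOneSpectrum (𝓞 ℚ) → ℕ)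
    (hSp : ∀ v ∈ S, ((p : ℕ) : 𝓞 ℚ) ∉ v.asIdeal)
    (hval : ∀ v ∈ S, padicValNat p (v.residueCard ^ (p - 1) - 1) = m v + 1)
    (hcv : ∀ v ∈ S,
      p ∣ (W.baseChange (v.adicCompletion ℚ)).localTamagawaNumber (v.adicCompletionIntegers ℚ))
    {κ : ZpExtension ℚ p} {γ : Field.absoluteGaloisGroup ℚ} (hκ : κ.IsCyclotomic)
    (D : W.SelmerDualData κ γ) [Module.Finite (IwasawaAlgebra p) D.X] (hX : D.IsTorsion)
    (hnf : ∀ N : Submodule (IwasawaAlgebra p) D.X, Finite N → N = ⊥) :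
    ∑ v ∈ S, p ^ min n (m v) ≤ lambdaInvariant p D.X + p ^ n * muInvariant p D.X := by
  haveI : NeZero p := ⟨hp.out.ne_zero⟩
  haveI : NumberField (κ.layer n) := numberField_layer κ n
  have hK : ∀ P : W.toAffine.Point, p • P = 0 → P = 0 :=
    fun P hP ↦ forall_smul_eq_zero_of_not_dvd_torsionOrder W p htors P (by convert hP)
  obtain ⟨κn, hκn⟩ := ZpTower.exists_restrictTower κ n
  obtain ⟨inv, hperf, hsum, -, hcompl⟩ := hPT κ hκ p
  -- places of `ℚ_n` over `S` with their witnesses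
  obtain ⟨T₀, hcard, hP⟩ := exists_finset_placesOver_card_ge S (fun v ↦ p ^ min n (m v))
    (fun v hv ↦ (pow_min_eq_natCard_placesOver_layer κ hκ hodd n (hSp v hv) (hval v hv)).le)
    (fun w ↦ ((p : ℕ) : 𝓞 (κ.layer n)) ∉ w.asIdeal ∧
      ∃ u ∈ unramifiedSubgroup
          (((W.baseChange (κ.layer n)).torsionGaloisModule (p : ℤ)).restrictField
            (w.adicCompletion (κ.layer n))) 1,
        u ∉ (W.baseChange (κ.layer n)).kummerLocalConditionAt (p : ℤ)
          (w.adicCompletion (κ.layer n)))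
    (fun v hv w hw ↦ ⟨natCast_not_mem_asIdeal_of_under_eq (hSp v hv) w hw,
      exists_mem_unramifiedSubgroup_not_mem_kummerLocalConditionAt_layer_of_odd_of_dvd_localTamagawaNumber
        hodd κ n (hSp v hv) (hcv v hv) w hw⟩)
  exact hcard.trans (GeneratorCountLayerTransport.card_le_lambda_add_pow_mul_mu_of_tamagawaWitnesses_layer
    n κn hκn D hodd hX hnf (fun P hP ↦ hK P (by convert hP)) hκ inv hperf hsum hcompl (hEP κ hκ) T₀
    (fun w hw ↦ (hP w hw).1) fun w hw ↦ (hP w hw).2)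

/-! ## §2. On the leaf X1 ∩ {r = 0}: the layer-`n` Tamagawa certificate as a membership set -/

/-- **`λ_alg ∈ {d | Σ_{v ∈ S} p^{min(n, m_v)} ≤ d + pⁿ m}` at a member with `μ_an ≤ m` and
`p ∤ #E(ℚ)_tors`** — good ordinary Eisenstein pair, `p ≠ 2`; Wuthrich Thm. 16 + modularity
(`μ(X) ≤ m`, FILE 3 `GeneratorCountMu.mu_le_of_analyticMuLE`), Greenberg Prop. 4.14 by name (no
finite submodule), Poitou–Tate / Euler–Poincaré over `ℚ_n`; census columns per row.
[cite: GreenbergLNM1716, §5 pp. 114–118, Prop. 4.14, p. 137] [cite: HachimoriMatsuno2000, Corollary (i)]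
[cite: Washington1997, §13.1] [cite: Wuthrich2014, Thm. 16 (p. 397)] -/
theorem AlgebraicLambdaMem.of_layerCertificates
    (hW16 : Wuthrich2014.charIdeal_dvd_padicLFunction) (hmod : nonempty_modularParametrizationData)
    (h414 : prop414_noFiniteSubmodule_of_not_dvd_torsionOrder)
    (hp2 : p ≠ 2) (hgood : W.HasGoodReductionAtPrime p) (hord : ¬ (p : ℤ) ∣ W.frobeniusTrace p)
    (hred : ¬ W.HasIrreducibleModPGaloisRep p) (htors : ¬ p ∣ W.torsionOrder) {m' : ℕ}
    (hμ : AnalyticMuLE W p m') (n : ℕ)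
    (hPT : ∀ (κ : ZpExtension ℚ p) [NumberField (κ.layer n)], κ.IsCyclotomic →
      poitouTate_selmerStructure_duality (κ.layer n))
    (hEP : ∀ (κ : ZpExtension ℚ p) [NumberField (κ.layer n)], κ.IsCyclotomic →
      ∀ w : HeightOneSpectrum (𝓞 (κ.layer n)),
      localEulerPoincareCharacteristic (w.adicCompletion (κ.layer n)))
    (S : Finset (HeightOneSpectrum (𝓞 ℚ))) (m : HeightOneSpectrum (𝓞 ℚ) → ℕ)
    (hSp : ∀ v ∈ S, ((p : ℕ) : 𝓞 ℚ) ∉ v.asIdeal)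
    (hval : ∀ v ∈ S, padicValNat p (v.residueCard ^ (p - 1) - 1) = m v + 1)
    (hcv : ∀ v ∈ S,
      p ∣ (W.baseChange (v.adicCompletion ℚ)).localTamagawaNumber (v.adicCompletionIntegers ℚ)) :
    AlgebraicLambdaMem W p {d | ∑ v ∈ S, p ^ min n (m v) ≤ d + p ^ n * m'} := by
  intro κ γ hκ hγ hγ' D _ hXt
  have hμD : D.mu ≤ m' :=
    GeneratorCountMu.mu_le_of_analyticMuLE hW16 hmod hp2 hgood hord hred hμ hκ hγ hγ' D
  have hnf : ∀ N : Submodule (IwasawaAlgebra p) D.X, Finite N → N = ⊥ :=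
    noFiniteSubmoduleAt_of_prop414 h414 htors hκ hγ hγ' D hXt
  have h := sum_pow_min_le_lambda_add_pow_mul_mu_of_certificates hp2 htors n hPT hEP S m hSp hval hcv
    hκ D hXt hnf
  have hμD' : muInvariant p D.X ≤ m' := hμD
  show ∑ v ∈ S, p ^ min n (m v) ≤ lambdaInvariant p D.X + p ^ n * m'
  exact h.trans (Nat.add_le_add_left (Nat.mul_le_mul_left _ hμD') _)

/-- **ROUTE T at layer `n` ∧ any layer-`0` certificate ⇒ BSD(E,p) on the leaf**, at a member of any
`μ` with `p ∤ #E(ℚ)_tors`: `MuPartAt ∧ μ_an ≤ m' ∧ λ_an = N ∧ (three census columns on S at layer n)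
∧ A' ∧ gap ⇒ BSD(E,p)`, gap check `∀ d ∈ A', Σ_{v∈S} p^{min(n,m_v)} ≤ d + pⁿm' → Even d → d ≤ N →
N ≤ d + 1` (`A'` = e.g. FILE 3's `{d | ∃ v, (d,v) ∈ S₀ ∧ B ≤ v ∧ B ≤ d + m'}` at layer `0`).
[cite: GreenbergLNM1716, Prop. 3.10, Thm. 4.1, Prop. 4.14, §5 pp. 114–118, p. 137]
[cite: Washington1997, §13.1–13.2] [cite: Wuthrich2014, Thm. 16 (p. 397)] -/
theorem Leaf.bsdp_of_muPartAt_of_layerCertificates_inter_of_prop414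
    (hW16 : Wuthrich2014.charIdeal_dvd_padicLFunction) (hGr : greenberg_charValue_rankZero)
    (h310 : prop310_selmerCorank_mod_two_eq_lambdaInvariant)
    (h414 : prop414_noFiniteSubmodule_of_not_dvd_torsionOrder)
    (hmod : nonempty_modularParametrizationData)
    (hGZK : rank_eq_analyticRank_of_analyticRank_le_one) (hL : RankZero.Leaf W p)
    (htors : ¬ p ∣ W.torsionOrder) (hμP : MuPartAt W p) {m' N : ℕ} (hμ : AnalyticMuLE W p m')
    (hlam : AnalyticLambdaEq W p N) (n : ℕ)
    (hPT : ∀ (κ : ZpExtension ℚ p) [NumberField (κ.layer n)], κ.IsCyclotomic →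
      poitouTate_selmerStructure_duality (κ.layer n))
    (hEP : ∀ (κ : ZpExtension ℚ p) [NumberField (κ.layer n)], κ.IsCyclotomic →
      ∀ w : HeightOneSpectrum (𝓞 (κ.layer n)),
      localEulerPoincareCharacteristic (w.adicCompletion (κ.layer n)))
    (S : Finset (HeightOneSpectrum (𝓞 ℚ))) (m : HeightOneSpectrum (𝓞 ℚ) → ℕ)
    (hSp : ∀ v ∈ S, ((p : ℕ) : 𝓞 ℚ) ∉ v.asIdeal)
    (hval : ∀ v ∈ S, padicValNat p (v.residueCard ^ (p - 1) - 1) = m v + 1)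
    (hcv : ∀ v ∈ S,
      p ∣ (W.baseChange (v.adicCompletion ℚ)).localTamagawaNumber (v.adicCompletionIntegers ℚ))
    {A' : Set ℕ} (hA' : AlgebraicLambdaMem W p A')
    (hgap : ∀ d ∈ A', ∑ v ∈ S, p ^ min n (m v) ≤ d + p ^ n * m' → Even d → d ≤ N → N ≤ d + 1) :
    BSDp W p :=
  have hX := isClassX1_of_classX1 hL.classX1
  GeneratorSqueeze.Leaf.bsdp_of_lambdaMem hW16 hGr h310 hmod hGZK hL hμP hlam
    (hA'.inter (AlgebraicLambdaMem.of_layerCertificates hW16 hmod h414 hX.two_ne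
      hX.hasGoodReductionAtPrime hX.not_dvd_frobeniusTrace hX.not_hasIrreducibleModPGaloisRep htors hμ
      n hPT hEP S m hSp hval hcv))
    fun d ⟨hd, hB⟩ ↦ hgap d hd hB

end Summit.BirchSwinnertonDyer.Rank1Residual.X1.GeneratorCountLayerCertificates

end
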